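import Summits.NavierStokesRegularity.NavierStokesRegularity.Theorems.StrainDoorsTypeIRecentring
import HarnessLib

/-!
# Strain doors, PART H — THE TANGENT VORTICITY FIELD OF A TYPE-I SOLUTION ATTAINS ITS VORTICITY NUMBER

(Tree file 1 of 2 of PART H — §H1 and the §H2 toolkit; `typeI_tangent_field` and §H3 are in
`StrainDoorsTypeITangentField`, which imports this file.  Text of nsreg-p1 g35 r58/StrainDoorsTypeITangentField.lean
sha256 9c3ae5615613774d, split at the 400-line cap, bodies verbatim; the copy `tendsto_apply_of_tendsto'` of the tree's
`ChaeWolf.tendsto_apply_of_tendsto` is dropped (gate dedup rule) and file 2 cites the original.)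

`Summit.NavierStokesRegularity.NavierStokesRegularity.Theorems.StrainDoors` (continued; nsreg-p1 g35 ROUND-58, helper
lane of `stmt-NavierStokesRegularity-0056`, rung N0; lands after PART G `StrainDoorsTypeIRecentring`).  Second piece
of the proof programme for door D14 (`TypeIVorticityTangentRecord`, PART F): THE LIMIT.

* §H1 `window_transfer_fderiv_time`, `exists_uniform_gradLipschitz` — for the Type-I class
  `{classical on t < 0, ν = 1, f = 0, |u| ≤ C₀/(|x|+√−t)}` the velocity GRADIENT is `K₂(C₀)`-Lipschitz in space
  and `L₁(C₀)`-Lipschitz in time on `t ≤ −1/4` (KNSS §4 (4.10)–(4.11) with `k = 1, 2` on windows, transferred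
  from the smooth representative `U` of `u = U + b(t)` to `u` at every time; the `k = 1` twin of the tree's
  `ChaeWolf.exists_uniform_lipschitz`).
* §H2 ★★ `typeI_tangent_field` — KNSS's compactness step WITH GRADIENTS: a sequence `(u_n, p_n)` in the class has
  a subsequence with `u_{φ(n)} → v`, `∇u_{φ(n)} → ∇v` pointwise on `t ≤ −1/4` (pointwise Arzelà–Ascoli on the
  pairs `(u_n, ∇u_n)`; the limit gradient IS `∇v` by the uniform quadratic Taylor bound), `curl u_{φ(n)}(t,x_n) →
  curl v(t,x₀)` along moving points, `v` Type-I, `∇v` jointly Lipschitz, and `t ↦ v(t − 1/4)` a bounded weak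
  ancient solution (tree `isBoundedWeakNSSolutionOn_of_tendsto`, as in `ChaeWolf.exists_limit`).
* §H3 ★★★ `typeI_tangent_vorticity_attains` — for every member with `ω ≢ 0`: the vorticity number
  `W* = sup (0−s)|ω(s,y)| ∈ (0,∞)` is ATTAINED by the tangent field of the recentred family of PART G:
  **`|curl v(−1, z̄)| = W*`**, with `(0−s)|curl v(s,y)| ≤ W*` on `s ≤ −1/4` — the supremum of `u` is an interior
  space-time MAXIMUM of the scale-invariant vorticity of `v`.  No symmetry, no self-similarity, no hypothesis
  beyond the class.  What door D14 asks beyond this file is only the LAW at `(−1, z̄)`, i.e. the vorticity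
  equation for `v`; by KNSS Lemma 3.1 (tree `KNSS2009_regularity_boundedWeak_window_holds`) `v = U + b(t)` with
  `U` smooth and the INTEGRATED vorticity identity with drift `U + b` — the drift-tolerant record law is R59.

[cite: KochNadirashviliSereginSverak2009 §2 p. 5 (recentring/attainment), §4 (4.10)–(4.11), Lemma 6.1 and proof
of Thm 6.1 p. 12 (arXiv:0709.3599); ChaeWolf2017RemovingDSS §3 Step 2 (arXiv:1610.09464 pp. 8–9); GigaMiura2011 §2.1]
-/

noncomputable section

open MeasureTheory Set Function Filter Metric Real InnerProductSpace
open _root_.Topology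
open scoped ENNReal NNReal RealInnerProductSpace ContDiff Laplacian
open Literature.Analysis Literature.Analysis.FluidPDE
open Literature.Analysis.FluidPDE.VorticityDirectionDynamics

set_option linter.unusedVariables false
set_option linter.unusedSectionVars false

namespace Summit.NavierStokesRegularity.NavierStokesRegularity.Theorems.StrainDoors

open Summit.NavierStokesRegularity.NavierStokesRegularity.Theorems.ArgmaxDoors

/-! # PART H — THE TANGENT VORTICITY FIELD OF A TYPE-I SOLUTION (R58) -/

/-! ## §H1 Uniform gradient-Lipschitz bounds on `t ≤ −1/4` (space: Hessian bound; time: KNSS (4.11), `k = 1`) -/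

/-- **Transfer of the KNSS time-Lipschitz bound of order one.**  If `w` is jointly smooth on `(0,T) × ℝ³` and
`w(τ,·) = U(τ,·) + b(τ)` a.e. in `x` for a.e. `τ`, with smooth slices `U(τ,·)` whose first derivatives are
`L₁`-Lipschitz in time on `(1,T)` (the `k = 1` clause of `KNSS2009_regularity_boundedWeak_window`), then
`‖∇w(τ,x) − ∇w(σ,x)‖ ≤ L₁|τ − σ|` for ALL `σ, τ ∈ (1,T)`: the drift `b(τ)` is constant in `x` and drops out of
`∇`, and continuity of `τ ↦ ∇w(τ,x)` removes the exceptional times (twice). [folklore] -/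
theorem window_transfer_fderiv_time {T L₁ : ℝ}
    {w U : ℝ → (EuclideanSpace ℝ (Fin 3)) → (EuclideanSpace ℝ (Fin 3))} {b : ℝ → EuclideanSpace ℝ (Fin 3)}
    (hw : IsSmoothSpaceTimeOn (Ioo 0 T) w)
    (hae : ∀ᵐ τ ∂((volume : Measure ℝ).restrict (Ioo 0 T)), w τ =ᵐ[volume] fun x => U τ x + b τ)
    (hUs : ∀ τ ∈ Ioo 0 T, ContDiff ℝ ∞ (U τ))
    (hUL : ∀ σ ∈ Ioo 1 T, ∀ τ ∈ Ioo 1 T, ∀ x,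
      ‖iteratedFDeriv ℝ 1 (U τ) x - iteratedFDeriv ℝ 1 (U σ) x‖ ≤ L₁ * |τ - σ|) :
    ∀ σ ∈ Ioo 1 T, ∀ τ ∈ Ioo 1 T, ∀ x : EuclideanSpace ℝ (Fin 3),
      ‖fderiv ℝ (w τ) x - fderiv ℝ (w σ) x‖ ≤ L₁ * |τ - σ| := by
  have hSU : UniqueDiffOn ℝ (Ioo 0 T) := isOpen_Ioo.uniqueDiffOn
  have hsub1 : Ioo 1 T ⊆ Ioo 0 T := Ioo_subset_Ioo_left zero_le_one
  have hwx : ∀ τ ∈ Ioo 0 T, Continuous (w τ) := fun τ hτ => (hw.contDiff_slice hτ).continuous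
  have hDτ : ∀ x, ContinuousOn (fun τ => fderiv ℝ (w τ) x) (Ioo 1 T) := fun x =>
    ((hw.continuousOn_fderiv_slice hSU).comp (continuousOn_id.prodMk continuousOn_const)
      (fun τ hτ => mk_mem_prod hτ (mem_univ x))).mono hsub1
  have hgood : ∀ᵐ τ ∂((volume : Measure ℝ).restrict (Ioo 0 T)),
      τ ∈ Ioo 0 T ∧ ∀ x, w τ x = U τ x + b τ := by
    filter_upwards [hae, ae_restrict_mem measurableSet_Ioo] with τ hτ hτm
    refine ⟨hτm, fun x => ?_⟩
    have hc2 : Continuous fun x => U τ x + b τ := (hUs τ hτm).continuous.add continuous_const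
    exact congr_fun ((Continuous.ae_eq_iff_eq volume (hwx τ hτm) hc2).1 hτ) x
  have hgood1 : ∀ᵐ τ ∂((volume : Measure ℝ).restrict (Ioo 1 T)),
      τ ∈ Ioo 0 T ∧ ∀ x, w τ x = U τ x + b τ :=
    ae_restrict_of_ae_restrict_of_subset hsub1 hgood
  -- between good times the drift drops out of the gradient
  have hgg : ∀ σ τ : ℝ, σ ∈ Ioo 1 T → τ ∈ Ioo 1 T → (∀ y, w σ y = U σ y + b σ) →
      (∀ y, w τ y = U τ y + b τ) → ∀ x, ‖fderiv ℝ (w τ) x - fderiv ℝ (w σ) x‖ ≤ L₁ * |τ - σ| := by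
    intro σ τ hσ hτ hσg hτg x
    have eτ : w τ = fun y => U τ y + b τ := funext hτg
    have eσ : w σ = fun y => U σ y + b σ := funext hσg
    rw [eτ, eσ, fderiv_add_const, fderiv_add_const, norm_fderiv_sub_eq_norm_iteratedFDeriv_one_sub]
    exact hUL σ hσ τ hτ x
  -- remove the exceptional `σ`, for good `τ`
  have hstep : ∀ τ ∈ Ioo 1 T, (∀ y, w τ y = U τ y + b τ) →
      ∀ σ ∈ Ioo 1 T, ∀ x, ‖fderiv ℝ (w τ) x - fderiv ℝ (w σ) x‖ ≤ L₁ * |τ - σ| := by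
    intro τ hτ hτg σ₀ hσ₀ x
    have hcont : ContinuousOn
        (fun σ => ‖fderiv ℝ (w τ) x - fderiv ℝ (w σ) x‖ - L₁ * |τ - σ|) (Ioo 1 T) := by
      refine ContinuousOn.sub (continuousOn_const.sub (hDτ x)).norm ?_
      exact continuousOn_const.mul (continuousOn_const.sub continuousOn_id).abs
    have key := ChaeWolf.le_of_ae_le_of_continuousOn (K := 0) hcont ?_ σ₀ hσ₀
    · linarith
    filter_upwards [hgood1, ae_restrict_mem measurableSet_Ioo] with σ hσ hσ1
    linarith [hgg σ τ hσ1 hτ hσ.2 hτg x]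
  -- remove the exceptional `τ`
  intro σ hσ τ₀ hτ₀ x
  have hcont : ContinuousOn
      (fun τ => ‖fderiv ℝ (w τ) x - fderiv ℝ (w σ) x‖ - L₁ * |τ - σ|) (Ioo 1 T) := by
    refine ContinuousOn.sub ((hDτ x).sub continuousOn_const).norm ?_
    exact continuousOn_const.mul (continuousOn_id.sub continuousOn_const).abs
  have key := ChaeWolf.le_of_ae_le_of_continuousOn (K := 0) hcont ?_ τ₀ hτ₀
  · linarith
  filter_upwards [hgood1, ae_restrict_mem measurableSet_Ioo] with τ hτ hτ1
  linarith [hstep τ hτ1 hτ.2 σ hσ x]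

/-- **Uniform gradient-Lipschitz bounds for Type-I classical solutions.**  For every `C₀ ≥ 0` there are
`K₂, L₁ ≥ 0` such that every classical solution `(u,p)` (`ν = 1`, `f = 0`) on `(−∞,0) × ℝ³` with
`HasTypeIDecay C₀ u` has, on `t ≤ −1/4`, a velocity gradient which is `K₂`-Lipschitz in space (mean value
inequality with the uniform Hessian bound `exists_uniform_hessBound`) and `L₁`-Lipschitz in time (KNSS §4
(4.11) with `k = 1` on the windows `(t − 2, t + 1/8)`, transferred by `window_transfer_fderiv_time`; times more
than `1` apart by the uniform bound `‖∇u‖ ≤ K`).  The `k = 1` twin of the tree's `ChaeWolf.exists_uniform_lipschitz`.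
[folklore-typed; cite: KochNadirashviliSereginSverak2009 §4 (4.10)–(4.11); ChaeWolf2017RemovingDSS §3 (3.6)] -/
theorem exists_uniform_gradLipschitz {C₀ : ℝ} (hC₀ : 0 ≤ C₀) :
    ∃ K₂ L₁ : ℝ, 0 ≤ K₂ ∧ 0 ≤ L₁ ∧ ∀ {u : ℝ → EuclideanSpace ℝ (Fin 3) → EuclideanSpace ℝ (Fin 3)}
      {p : ℝ → EuclideanSpace ℝ (Fin 3) → ℝ},
      IsClassicalNSSolutionOn (Iio 0) 1 0 u p → HasTypeIDecay C₀ u →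
        (∀ t ≤ -(1 / 4 : ℝ), ∀ x y, ‖fderiv ℝ (u t) x - fderiv ℝ (u t) y‖ ≤ K₂ * ‖x - y‖) ∧
        (∀ s ≤ -(1 / 4 : ℝ), ∀ t ≤ -(1 / 4 : ℝ), ∀ x,
          ‖fderiv ℝ (u t) x - fderiv ℝ (u s) x‖ ≤ L₁ * |t - s|) := by
  obtain ⟨K₂, hK₂, hhess⟩ := exists_uniform_hessBound hC₀
  obtain ⟨K, L, hK, hL, hKL⟩ := ChaeWolf.exists_uniform_lipschitz hC₀
  obtain ⟨Cw, Lw, N, hwin⟩ :=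
    KNSS2009_regularity_boundedWeak_window_holds (3 * C₀) (17 / 8) (by norm_num)
  refine ⟨K₂, max (Lw 1 1) (2 * K), hK₂, le_max_of_le_right (by positivity), ?_⟩
  intro u p hcl hI
  -- the window based at a time `t ≤ -1/4`
  have hwindow : ∀ t ≤ -(1 / 4 : ℝ), ∀ s, t - 1 < s → s ≤ t → ∀ x,
      ‖fderiv ℝ (u t) x - fderiv ℝ (u s) x‖ ≤ Lw 1 1 * |t - s| := by
    intro t ht
    set a : ℝ := t - 2 with ha
    set w : ℝ → EuclideanSpace ℝ (Fin 3) → EuclideanSpace ℝ (Fin 3) := fun τ => u (τ + a) with hw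
    have hIoo : Ioo a (a + 17 / 8) ⊆ Iio 0 := fun τ hτ => by
      simp only [mem_Iio]; linarith [hτ.2]
    have hneg : ∀ τ ∈ Ioo (0 : ℝ) (17 / 8), τ + a < -(1 / 8 : ℝ) := fun τ hτ => by
      linarith [hτ.2]
    have hcl' : IsClassicalNSSolutionOn (Ioo a (a + 17 / 8)) 1 0 u p :=
      hcl.mono hIoo (uniqueDiffOn_Ioo _ _)
    have hbdd : IsBoundedOn (Ioo a (a + 17 / 8)) u :=
      ⟨3 * C₀, fun τ hτ x => ChaeWolf.typeI_norm_le_three_mul hC₀ hI (by linarith [hτ.2]) x⟩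
    have hweak : IsBoundedWeakNSSolutionOn (Ioo 0 (17 / 8)) isOpen_Ioo 1 w :=
      (hcl'.isBoundedWeakNSSolutionOn hbdd).comp_add_right a (J := Ioo 0 (17 / 8)) isOpen_Ioo
        fun τ => by
          simp only [mem_Ioo]
          constructor <;> intro h <;> constructor <;> linarith [h.1, h.2]
    have hM : ∀ τ ∈ Ioo (0 : ℝ) (17 / 8), ∀ x, ‖w τ x‖ ≤ 3 * C₀ := fun τ hτ x =>
      ChaeWolf.typeI_norm_le_three_mul hC₀ hI (hneg τ hτ) x
    obtain ⟨U, b, -, -, -, hae, hUs, -, -, hUL, -⟩ := hwin hweak hM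
    have hws : IsSmoothSpaceTimeOn (Ioo 0 (17 / 8)) w := by
      have h1 := hcl.smooth_velocity.comp_add_right a
      refine h1.mono fun τ hτ => ?_
      simp only [mem_preimage, mem_Iio]
      linarith [hneg τ hτ]
    have htm := window_transfer_fderiv_time hws hae hUs (hUL 1 one_pos 1)
    have h2 : (2 : ℝ) ∈ Ioo (1 : ℝ) (17 / 8) := ⟨by norm_num, by norm_num⟩
    have e2 : w 2 = u t := by simp only [hw, ha]; congr 1; ring
    intro s hs1 hs2 x
    have hs' : s - a ∈ Ioo (1 : ℝ) (17 / 8) := ⟨by rw [ha]; linarith, by rw [ha]; linarith⟩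
    have key := htm (s - a) hs' 2 h2 x
    have es : w (s - a) = u s := by simp only [hw]; congr 1; ring
    have eabs : |(2 : ℝ) - (s - a)| = |t - s| := by rw [ha]; congr 1; ring
    rwa [e2, es, eabs] at key
  refine ⟨fun t ht x y => ?_, fun s hs t ht x => ?_⟩
  · -- spatial bound: mean value inequality for `∇u(t,·)` with `‖D²u‖ ≤ K₂`
    have ht0 : t ∈ Iio (0 : ℝ) := by simp only [mem_Iio]; linarith
    have hd : Differentiable ℝ (fderiv ℝ (u t)) :=
      ((hcl.contDiff_velocity ht0).fderiv_right (m := 1) (by norm_cast)).differentiable (by norm_cast)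
    have hdiff : ∀ z ∈ (univ : Set (EuclideanSpace ℝ (Fin 3))),
        DifferentiableAt ℝ (fderiv ℝ (u t)) z := fun z _ => hd z
    have hbound : ∀ z ∈ (univ : Set (EuclideanSpace ℝ (Fin 3))),
        ‖fderiv ℝ (fderiv ℝ (u t)) z‖ ≤ K₂ := by
      intro z _
      rw [← norm_iteratedFDeriv_zero (𝕜 := ℝ) (f := fderiv ℝ (fderiv ℝ (u t))),
        norm_iteratedFDeriv_fderiv, norm_iteratedFDeriv_fderiv]
      exact hhess hcl hI t ht z
    exact Convex.norm_image_sub_le_of_norm_fderiv_le hdiff hbound convex_univ (mem_univ y)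
      (mem_univ x)
  · -- temporal bound
    rcases le_or_gt 1 |t - s| with hfar | hnear
    · have hb : ∀ r ≤ -(1 / 4 : ℝ), ‖fderiv ℝ (u r) x‖ ≤ K := by
        intro r hr
        have hlip : LipschitzWith (Real.toNNReal K) (u r) :=
          LipschitzWith.of_dist_le_mul fun a b => by
            rw [dist_eq_norm, dist_eq_norm, Real.coe_toNNReal K hK]
            exact (hKL hcl hI).1 r hr a b
        have h := norm_fderiv_le_of_lipschitz ℝ hlip (x₀ := x)
        rwa [Real.coe_toNNReal K hK] at h
      calc ‖fderiv ℝ (u t) x - fderiv ℝ (u s) x‖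
          ≤ ‖fderiv ℝ (u t) x‖ + ‖fderiv ℝ (u s) x‖ := norm_sub_le _ _
        _ ≤ K + K := add_le_add (hb t ht) (hb s hs)
        _ = 2 * K * 1 := by ring
        _ ≤ max (Lw 1 1) (2 * K) * |t - s| := by
            gcongr
            · exact le_max_right _ _
    · have habs := abs_lt.1 hnear
      have hLle : Lw 1 1 * |t - s| ≤ max (Lw 1 1) (2 * K) * |t - s| :=
        mul_le_mul_of_nonneg_right (le_max_left _ _) (abs_nonneg _)
      rcases le_total s t with hst | hts
      · exact (hwindow t ht s (by linarith [habs.2]) hst x).trans hLle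
      · have key := hwindow s hs t (by linarith [habs.1]) hts x
        rw [norm_sub_rev, abs_sub_comm] at key
        exact key.trans hLle


/-! ## §H2 Extraction of the tangent field: pointwise Arzelà–Ascoli on the pairs `(u_n, ∇u_n)` -/

/-- `‖∇f‖ ≤ K` for a map with `‖f x − f y‖ ≤ K‖x − y‖`. [folklore] -/
theorem norm_fderiv_le_of_dist_le {F : Type*} [NormedAddCommGroup F] [NormedSpace ℝ F]
    {f : EuclideanSpace ℝ (Fin 3) → F} {K : ℝ} (hK : 0 ≤ K)
    (h : ∀ x y, ‖f x - f y‖ ≤ K * ‖x - y‖) (x : EuclideanSpace ℝ (Fin 3)) : ‖fderiv ℝ f x‖ ≤ K := by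
  have hlip : LipschitzWith (Real.toNNReal K) f :=
    LipschitzWith.of_dist_le_mul fun a b => by
      rw [dist_eq_norm, dist_eq_norm, Real.coe_toNNReal K hK]
      exact h a b
  have h' := norm_fderiv_le_of_lipschitz ℝ hlip (x₀ := x)
  rwa [Real.coe_toNNReal K hK] at h'

/-- Freezing at `t = −1/4`: a field `K`-Lipschitz in `x` and `L`-Lipschitz in `t` on `t ≤ −1/4` gives a
`(K + L)`-Lipschitz map `(t,x) ↦ g(t ∧ (−1/4), x)` on `ℝ × ℝ³` (sup metric). [folklore] -/
theorem lipschitzWith_freeze {F : Type*} [NormedAddCommGroup F]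
    {g : ℝ → EuclideanSpace ℝ (Fin 3) → F} {K L : ℝ} (hK : 0 ≤ K) (hL : 0 ≤ L)
    (hsp : ∀ t ≤ -(1 / 4 : ℝ), ∀ x y, ‖g t x - g t y‖ ≤ K * ‖x - y‖)
    (htm : ∀ s ≤ -(1 / 4 : ℝ), ∀ t ≤ -(1 / 4 : ℝ), ∀ x, ‖g t x - g s x‖ ≤ L * |t - s|) :
    LipschitzWith (K + L).toNNReal
      (fun q : ℝ × EuclideanSpace ℝ (Fin 3) => g (min q.1 (-(1 / 4 : ℝ))) q.2) := by
  refine LipschitzWith.of_dist_le_mul fun q q' => ?_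
  rw [Real.coe_toNNReal _ (by positivity), dist_eq_norm, Prod.dist_eq, Real.dist_eq, dist_eq_norm]
  have hm : min q.1 (-(1 / 4 : ℝ)) ≤ -(1 / 4 : ℝ) := min_le_right _ _
  have hm' : min q'.1 (-(1 / 4 : ℝ)) ≤ -(1 / 4 : ℝ) := min_le_right _ _
  have hmin : |min q.1 (-(1 / 4 : ℝ)) - min q'.1 (-(1 / 4 : ℝ))| ≤ |q.1 - q'.1| := by
    refine (abs_min_sub_min_le_max _ _ _ _).trans (max_le le_rfl ?_)
    rw [sub_self, abs_zero]; exact abs_nonneg _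
  calc ‖g (min q.1 (-(1 / 4))) q.2 - g (min q'.1 (-(1 / 4))) q'.2‖
      ≤ ‖g (min q.1 (-(1 / 4))) q.2 - g (min q.1 (-(1 / 4))) q'.2‖ +
          ‖g (min q.1 (-(1 / 4))) q'.2 - g (min q'.1 (-(1 / 4))) q'.2‖ :=
        norm_sub_le_norm_sub_add_norm_sub _ _ _
    _ ≤ K * ‖q.2 - q'.2‖ + L * |min q.1 (-(1 / 4 : ℝ)) - min q'.1 (-(1 / 4 : ℝ))| :=
        add_le_add (hsp _ hm _ _) (htm _ hm' _ hm _)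
    _ ≤ K * max |q.1 - q'.1| ‖q.2 - q'.2‖ + L * max |q.1 - q'.1| ‖q.2 - q'.2‖ := by
        gcongr
        · exact le_max_right _ _
        · exact hmin.trans (le_max_left _ _)
    _ = (K + L) * max |q.1 - q'.1| ‖q.2 - q'.2‖ := by ring

/-- Quadratic Taylor bound from a Lipschitz gradient: `‖f(x+h) − f(x) − ∇f(x)h‖ ≤ K|h|²`. [folklore] -/
theorem taylor_quadratic_of_fderiv_lipschitz {F : Type*} [NormedAddCommGroup F] [NormedSpace ℝ F]
    {f : EuclideanSpace ℝ (Fin 3) → F} (hd : Differentiable ℝ f) {K : ℝ} (hK : 0 ≤ K)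
    (hL : ∀ x y, ‖fderiv ℝ f x - fderiv ℝ f y‖ ≤ K * ‖x - y‖) (x h : EuclideanSpace ℝ (Fin 3)) :
    ‖f (x + h) - f x - fderiv ℝ f x h‖ ≤ K * ‖h‖ ^ 2 := by
  have hdiff : ∀ z ∈ closedBall x ‖h‖, DifferentiableAt ℝ f z := fun z _ => hd z
  have hbd : ∀ z ∈ closedBall x ‖h‖, ‖fderiv ℝ f z - fderiv ℝ f x‖ ≤ K * ‖h‖ := by
    intro z hz
    rw [mem_closedBall, dist_eq_norm] at hz
    calc ‖fderiv ℝ f z - fderiv ℝ f x‖ ≤ K * ‖z - x‖ := hL z x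
      _ ≤ K * ‖h‖ := by gcongr
  have hy : x + h ∈ closedBall x ‖h‖ := by
    rw [mem_closedBall, dist_eq_norm, add_sub_cancel_left]
  have key := Convex.norm_image_sub_le_of_norm_fderiv_le' hdiff hbd (convex_closedBall x ‖h‖)
    (mem_closedBall_self (norm_nonneg h)) hy
  rw [add_sub_cancel_left] at key
  calc ‖f (x + h) - f x - fderiv ℝ f x h‖ ≤ K * ‖h‖ * ‖h‖ := key
    _ = K * ‖h‖ ^ 2 := by ring

/-- Differentiability of a pointwise limit from uniform quadratic Taylor bounds and convergence of the
gradients at the point. [folklore] -/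
theorem hasFDerivAt_of_tendsto_of_quadratic {F : Type*} [NormedAddCommGroup F] [NormedSpace ℝ F]
    {f : ℕ → EuclideanSpace ℝ (Fin 3) → F} {A : ℕ → (EuclideanSpace ℝ (Fin 3) →L[ℝ] F)}
    {g : EuclideanSpace ℝ (Fin 3) → F} {B : EuclideanSpace ℝ (Fin 3) →L[ℝ] F} {K : ℝ}
    {x : EuclideanSpace ℝ (Fin 3)}
    (hT : ∀ n h, ‖f n (x + h) - f n x - A n h‖ ≤ K * ‖h‖ ^ 2)
    (hf : ∀ y, Tendsto (fun n => f n y) atTop (𝓝 (g y))) (hA : Tendsto A atTop (𝓝 B)) :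
    HasFDerivAt g B x := by
  have hT' : ∀ h, ‖g (x + h) - g x - B h‖ ≤ K * ‖h‖ ^ 2 := by
    intro h
    have hBh : Tendsto (fun n => A n h) atTop (𝓝 (B h)) :=
      ((ContinuousLinearMap.apply ℝ F h).continuous.tendsto B).comp hA
    have hlim : Tendsto (fun n => f n (x + h) - f n x - A n h) atTop (𝓝 (g (x + h) - g x - B h)) :=
      ((hf (x + h)).sub (hf x)).sub hBh
    exact le_of_tendsto' hlim.norm fun n => hT n h
  rw [hasFDerivAt_iff_isLittleO_nhds_zero, Asymptotics.isLittleO_iff]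
  intro c hc
  rcases le_or_gt K 0 with hK | hK
  · refine Filter.Eventually.of_forall fun h => (hT' h).trans ?_
    exact (mul_nonpos_of_nonpos_of_nonneg hK (sq_nonneg _)).trans (by positivity)
  · filter_upwards [Metric.ball_mem_nhds (0 : EuclideanSpace ℝ (Fin 3)) (div_pos hc hK)] with h hh
    rw [mem_ball_zero_iff] at hh
    calc ‖g (x + h) - g x - B h‖ ≤ K * ‖h‖ ^ 2 := hT' h
      _ = (K * ‖h‖) * ‖h‖ := by ring
      _ ≤ c * ‖h‖ := by
          gcongr
          calc K * ‖h‖ ≤ K * (c / K) := by gcongr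
            _ = c := by field_simp

end Summit.NavierStokesRegularity.NavierStokesRegularity.Theorems.StrainDoors

end
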